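import Summits.QuantumFields.BalabanUV.T4Continuum.Support.NE9LinSizeEndCPiece
import Summits.QuantumFields.BalabanUV.T4Continuum.Support.NE9Lemma1RemainderSpecies

/-!
# NE9LinSizeEndRemSpecies — E5′-REM: the d-currency torus END face of row NE9 AT THE DISPLAYED SPECIES — the (1.23)-pieces of the
FIFTH-ORDER TAYLOR REMAINDER of an analytic old term — ON THE ANALYTIC CLASS, with the channel-side S-binders S2 / S5 (and the
zero / locality / source / step-sum structure) DISCHARGED BY THE KERNEL (cell `pub-balaban`, T4-DAG §2 node U3 / §6 NE9; rung (B)+1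
on a FIXED finite T⁴; NE9 formalisation crew, unit `b2b-balaban-t4-ne9-formalise-leaf-07` gen 4; composition BY NAME of this
lineage's E5′-πG-CL `NE9LinSizeEndCPiece` (p212669) with the row owner's part 2 `NE9Lemma1RemainderSpecies` (t4-ne9-p1-g24,
p212850 — the byte-identical re-file of p212584); nothing of either is modified, no END re-wired)

HONEST FRAMING (T4-DAG PAGE 1).  Rung (B)+1 = existence and uniqueness of the ε → 0 limit of gauge-invariant observables on a
FIXED finite torus T⁴ — NOT infinite volume, NOT a mass gap, NOT the Clay problem.  NE9 is a cell NEW ESTIMATE, NOT PRINTED and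
NOT discharged here («NE9 ⇐ the named binders»).  What is kernel here is FORM-LEVEL: the species is the owner's `RemData.toC` —
the (1.23) contour functional of the fifth-order remainder along displayed contour directions, on the doubled (re/im) carriers —
and its identification with Bałaban's actual (1.23)/(1.33) pieces is O-NE9-1 (NODE O), NOT claimed.  DISPLAYED (binders, never
asserted): the datum's admissibility `RemData.Admissible` (κ₁ ≥ 1, radii, direction sizes `‖dir‖ ≤ dirB < R_X`, `dirB ≤ c_dir·ℓ·R_X`
— the DOMAIN INCLUSION of [I] (3.36) p. 277 —, source discipline, G1 = [II] (1.25)); S1 `AdmissibleTerms E W (analyticClass R)`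
([I] (1.18) p. 263: the renormalised terms are analytic on 𝔘^c_j — TYPE); the additivity of the pieces in the old term ON THE
ANALYTIC CLASS `PieceAdditiveOn (analyticClass R) Dd.toC` (linearity of (1.23); crew row (w16)); the level counts `LevelCountsG`
of [II] p. 8 on the species' index frame; `Factorises` / `LastCouplingLipschitz` at `cpieceChannel Dd.toC`; and every activity /
geometry / (A″) / (L‴) binder of E5′ VERBATIM.  0 `def`, 0 `sorry`; [I]/[II] locators are TYPE locators (ABSOLUTE RULE);
`FlowStep.BetaPertH`, (B), (B^μ) do not occur.  HONEST DEPENDENCY (verbatim): continuum YM on T⁴ ⇐ BetaPertH ∧ nine spine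
estimates (0/9 proved); BetaPertH ⇐ (D1) ∧ (D4) ∧ CAP+tail; G-an2-4 gates asym, D1 and NE2/3/4.

WHAT IS PROVED (kernel).
§1 **E5′-REM `torus_termSize_ne9_and_fadingMemory_of_linSizeDischargers_remSpecies`** — E5′-πG-CL (p212669) at `P := Dd.toC`,
   `Adm := analyticClass Dd.R`, `κ₁ := Dd.κ₁`, `Kp := KpOf Dd c_dir` (= 64·c_dir⁵/r_k), `gain := (ℓ k j)⁵`, with
   **S2 `AdmRestrict` ⇐ `admRestrict_analyticClass`**, **`PieceZero`/`PieceLocal`/`CSrcScale` ⇐ `pieceZero_rem`/`pieceLocal_rem`/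
   `csrcScale_rem`**, **S5's per-piece bound `PieceBoundOnG (analyticClass R)` ⇐ `pieceBoundOnG_rem`** (analyticity + iterated
   Schwarz + `B13Sect1Arith.bound_124`/`bound_125` — the owner's parts 5/2), `hKp`/`hgain` ⇐ `kpOf_nonneg`/`pow_nonneg` — ALL BY NAME.
   Conclusion LITERALLY E5′-πG's: `TermSize E W κ Nsz ∧ NE9 E W κ (prodModuli ℓ fun _ => μ) ∧ FadingMemory (ℓ/μ) μ (…)`,
   **`μ = ω + 4·lipbar·(a₁·e^{−a″(ν+1)})·c_Q`**.  On the channel side the face now displays ONLY: `RemData.Admissible`, S1,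
   `PieceAdditiveOn (analyticClass R)`, `LevelCountsG`, the letters `0 ≤ O1`, `0 ≤ c_Q`, `0 < ω`.
§2 **E5′-REM-π `…_remSpeciesPrinted`** — the same at the DISPLAYED species' own rate letter `ω := L⁻¹` (`1 < L`; [II] p. 8
   l. 9–10: gain exponent α = 1, ℓ = L^jη, c_Q = (6L)⁴ — O-ne9p1g23-1 keeps `L^{−β}` for the (4.30)-species, which is NOT this
   family): rate letter **`L⁻¹ + 4·lipbar·(a₁·e^{−a″(ν+1)})·c_Q`** = E5′-π's (p211212) with `(6L)⁴ ↦ c_Q`.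
DISGUISE TEST: one-history statements about a linear channel of ONE run at a FORM-level species; S5 is the fading SOURCE, not
NE9; nothing is asserted about Bałaban's 𝐇_k, 𝔘^c_j or (1.33).

References (TYPE locators only; nothing printed is a hypothesis): T. Bałaban, CMP **109** (1987) [Balaban1987RG1] (0.23) p. 256,
(0.29)–(0.30) p. 258, (1.18) p. 263, (3.34)–(3.36) p. 277, (3.54) p. 280, (4.18) p. 285, p. 288; CMP **116** (1988)
[Balaban1988RG2Cluster] (1.10) p. 4, (1.22)–(1.29) pp. 7–8, (1.33)–(1.36) p. 9, (2.27) p. 18, (2.38) p. 20, (2.41) p. 21;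
R. Kotecký, D. Preiss, CMP **103** (1986) [KoteckyPreiss1986].
-/

noncomputable section

namespace Summit.QuantumFields.BalabanUV.T4Continuum.NE9LinSizeEndRemSpecies

open scoped BigOperators
open Metric Set MeasureTheory BoundedContinuousFunction
open Literature.Probability.LatticeModels
open Literature.MathematicalPhysics.QuantumFieldTheory
open Literature.MathematicalPhysics.QuantumFieldTheory.Balaban1983to89
open Literature.MathematicalPhysics.QuantumFieldTheory.Balaban1983to89.T4OutputRate
open Literature.MathematicalPhysics.QuantumFieldTheory.Balaban1983to89.T4ActivityLipschitz
open Literature.MathematicalPhysics.QuantumFieldTheory.Balaban1983to89.T4HistoryLipschitzRecursion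
open Literature.MathematicalPhysics.QuantumFieldTheory.Balaban1983to89.T4HistoryLipschitzOuter
open Literature.MathematicalPhysics.QuantumFieldTheory.Balaban1983to89.T4HistoryLipschitzActivity
open Literature.MathematicalPhysics.QuantumFieldTheory.Balaban1983to89.T4HistoryLipschitzEntropy
open Literature.MathematicalPhysics.QuantumFieldTheory.Balaban1983to89.T4HistoryLipschitzCubeGeometry
open Literature.MathematicalPhysics.QuantumFieldTheory.Balaban1983to89.T4HistoryLipschitzActivity (ClusterGeom)
open Literature.MathematicalPhysics.QuantumFieldTheory.Balaban1983to89.T4HistoryLipschitzSegment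
open Literature.MathematicalPhysics.QuantumFieldTheory.Balaban1983to89.T4HistoryLipschitzLinearSize
open Summit.QuantumFields.BalabanUV.T4Continuum.NE9Lemma1Counting
open Summit.QuantumFields.BalabanUV.T4Continuum.NE9Lemma1Gain
open Summit.QuantumFields.BalabanUV.T4Continuum.NE9Lemma1PieceClass
open Summit.QuantumFields.BalabanUV.T4Continuum.NE9ComplexEncoding (doubleCarriers)
open Summit.QuantumFields.BalabanUV.T4Continuum.NE9Lemma1RemainderSpecies
open Summit.QuantumFields.BalabanUV.T4Continuum.NE9LinSizeEnd
open Summit.QuantumFields.BalabanUV.T4Continuum.NE9LinSizeEndCPiece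

variable {ν N : ℕ} {C : Carriers} {D : ℕ}
variable {Bg : Type} [NormedAddCommGroup Bg] [NormedSpace ℂ Bg] {Sp : Type*} [TopologicalSpace Sp] [MeasurableSpace Sp]
  [OpensMeasurableSpace Sp] {F : Type*} [Fintype F] {Ω : Type*} [MeasurableSpace Ω]

/-! ## §1 E5′-REM: E5′ at the displayed species on the analytic class -/

section Species

/-- **E5′-REM — E5′ AT THE DISPLAYED SPECIES ON THE ANALYTIC CLASS (kernel composition BY NAME).**  This lineage's E5′-πG-CL
(`NE9LinSizeEndCPiece`) at `P := Dd.toC` — the owner's FORM-level species: piece at the source (X, re/im) = Re/Im of the (1.23)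
contour functional `remPiece e^{κ₁} r_k cubes (lift H X) 5 dir` of the FIFTH-ORDER Taylor remainder of the complex old term along
the displayed contour directions — and `Adm := analyticClass Dd.R`.  KERNEL (owner's parts 2/5 BY NAME): S2 `AdmRestrict`
(`admRestrict_analyticClass`), `PieceZero`/`PieceLocal`/`CSrcScale` (`pieceZero_rem`, `pieceLocal_rem`, `csrcScale_rem`), and the
S5 per-piece bound **`PieceBoundOnG (analyticClass R) Dd.toC κ κ₁ d₀ (KpOf Dd c_dir) (ℓ⁵)`** (`pieceBoundOnG_rem`: analyticity of the
input on the ball of radius R_X, iterated Schwarz, (1.24)/(1.25) bookkeeping).  DISPLAYED on the channel side: the datum's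
admissibility `hD` ((I.3.36) domain inclusion `dirB < R_X`, `dirB ≤ c_dir·ℓ·R_X`; radii; G1), S1 `hAdm` (the renormalised terms are
analytic, [I] (1.18)), the pieces' additivity in the old term on the analytic class `hA` (crew row (w16)), the level counts `hLev`
([II] p. 8), letters; every activity / geometry / (A″) / (L‴) binder of E5′ VERBATIM.  Conclusion: E5′-πG's root shape with rate
letter **`μ = ω + 4·lipbar·(a₁·e^{−a″(ν+1)})·c_Q`**.
[cite: Balaban1987RG1, (1.18) p.263, (3.36) p.277, (3.54) p.280; Balaban1988RG2Cluster, (1.23)-(1.29) pp.7-8, (1.33) p.9, (2.27) p.18, (2.38) p.20, (2.41) p.21; KoteckyPreiss1986, (1)-(3)] -/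
theorem torus_termSize_ne9_and_fadingMemory_of_linSizeDischargers_remSpecies
    (Γ : CubeChart (doubleCarriers C) (Fin ν → ZMod N) (torusAdj ν N) D) {ι αi βi γi δ : Type} [DecidableEq δ]
    (Dd : RemData C Bg ι αi βi γi δ) {ℓr : ℕ → ℕ → ℝ} {cdir d0 : ℝ}
    {E : Functional (doubleCarriers C) Bg} {W : Set (ℕ → ℝ)}
    {Ψ : ℕ → ℝ → (ι → ℝ) → Bg → (doubleCarriers C).Dom → ℝ}
    {μ : ℕ → ℝ → Bg → Finset (Fin ν → ZMod N) → Measure Ω} {pre : ℕ → ℝ → Bg → Finset (Fin ν → ZMod N) → Ω → ℂ}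
    {c : ℕ → ℝ → Bg → Finset (Fin ν → ZMod N) → Ω → F → ℂ}
    {pt : ℕ → ℝ → Bg → Finset (Fin ν → ZMod N) → Ω → F → Sp} {β : ℕ → Sp → ℝ}
    {dom : ℕ → Finset (Fin ν → ZMod N) → F → Finset (Fin ν → ZMod N)}
    {lip ε' α4 : ℕ → ℝ} {a₁ a'' κ O1 cQ ω lipbar ℓ a a' : ℝ}
    {lam p₀ Nsz : ℕ → ℝ}
    (ρ : ℕ → (ι → ℝ) → (Sp →ᵇ ℂ))
    -- the DISPLAYED SPECIES: its datum is admissible ((I.3.36) domain inclusion, radii, G1 — TYPE), the scale letter ℓ ≥ 0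
    (hD : Dd.Admissible ℓr cdir d0) (hℓr : ∀ k j, 0 ≤ ℓr k j)
    -- S1 (the renormalised terms lie in the ANALYTIC class — [I] (1.18) p. 263, TYPE) and scale-zero freeness
    (h0 : ScaleZeroFree E W) (hAdm : AdmissibleTerms E W (analyticClass Dd.R))
    -- S3's remaining half: additivity of the (1.23)-pieces in the old term ON THE ANALYTIC CLASS (crew row (w16); displayed here)
    (hA : PieceAdditiveOn (analyticClass Dd.R) Dd.toC)
    -- the level counts of [II] p. 8 on the species' index frame, against `c_Q·ω^{k−j}` (displayed), and the letters
    (hLev : LevelCountsG Dd.toC.frame κ Dd.κ₁ O1 cQ (fun k j => ℓr k j ^ 5) (agePow ω))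
    (hO1 : 0 ≤ O1) (hcQ : 0 ≤ cQ) (hω : 0 < ω)
    -- E5′'s remaining recursion-side binders at `T := cpieceChannel Dd.toC`, `wt := weightOf Dd.toC.frame Dd.κ₁ d0 O1 (KpOf Dd cdir)`
    (hfac : Factorises E W (cpieceChannel Dd.toC) Ψ) (hlast : LastCouplingLipschitz E W (cpieceChannel Dd.toC) Ψ κ lam)
    (hρ : ∀ (k : ℕ) (Q Q' : ι → ℝ) (M : ℝ), (∀ y, |Q y - Q' y| ≤ weightOf Dd.toC.frame Dd.κ₁ d0 O1 (KpOf Dd cdir) k y * M) →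
      ‖ρ k Q - ρ k Q'‖ ≤ M)
    (hΨ : ∀ (k : ℕ) (s : ℝ) (Q Q' : ι → ℝ) (U : Bg) (X : (doubleCarriers C).Dom),
      Ψ k s Q U X - Ψ k s Q' U X =
        (Γ.geom.newTerm (Γ.geom.avgExpLinearAct μ pre fun k s U γ ω => evalFunctional (c k s U γ ω) (pt k s U γ ω))
            k s U X (ρ k Q) -
          Γ.geom.newTerm (Γ.geom.avgExpLinearAct μ pre fun k s U γ ω => evalFunctional (c k s U γ ω) (pt k s U γ ω))
            k s U X (ρ k Q')).re)
    (hexpl : ∀ g ∈ W, ∀ (k : ℕ) (Q : ι → ℝ) (U : Bg) (X : (doubleCarriers C).Dom), (doubleCarriers C).scale X = k + 1 →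
      |Ψ k (g k) Q U X -
          (Γ.geom.newTerm (Γ.geom.avgExpLinearAct μ pre fun k s U γ ω => evalFunctional (c k s U γ ω) (pt k s U γ ω))
            k (g k) U X (ρ k Q)).re| ≤ Real.exp (-(κ * (doubleCarriers C).d X)) * p₀ k)
    (hbase : ∀ g ∈ W, ∀ (U : Bg) (X : (doubleCarriers C).Dom), (doubleCarriers C).scale X = 0 → |E g U X| ≤ Real.exp (-(κ * (doubleCarriers C).d X)) * Nsz 0)
    (hNsucc : ∀ j, p₀ j + a₁ * Real.exp (-(a'' * (ν + 1))) ≤ Nsz (j + 1)) (hNnn : ∀ j, 0 ≤ Nsz j)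
    (hbox : ∀ (k : ℕ) (Q : ι → ℝ),
      (∀ y, |Q y| ≤ weightOf Dd.toC.frame Dd.κ₁ d0 O1 (KpOf Dd cdir) k y * sizeRadius (tauOfG cQ (agePow ω)) Nsz k) → ∀ x, ‖ρ k Q x‖ ≤ β k x)
    (hpre : ∀ k s U γ, AEStronglyMeasurable (pre k s U γ) (μ k s U γ))
    (hc : ∀ k s U γ Y, AEStronglyMeasurable (fun ω => c k s U γ ω Y) (μ k s U γ))
    (hpt : ∀ k s U γ Y, Measurable fun ω => pt k s U γ ω Y) (hlip : ∀ k, 0 < lip k) (hlipb : ∀ k, lip k ≤ lipbar)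
    (hint₀ : ∀ k s U γ, Integrable (fun ω => ‖pre k s U γ ω‖ * Real.exp (boxExponent c pt β k s U γ ω)) (μ k s U γ))
    (hmeet : ∀ k s U (γ : Finset (Fin ν → ZMod N)) ω Y, c k s U γ ω Y ≠ 0 → ∃ x ∈ γ, x ∈ dom k γ Y)
    (hα4 : ∀ k, 0 ≤ α4 k) (ha : (2:ℝ) ^ ν * Real.log 2 + Real.log (8 * ν) ≤ a)
    (hliplb : ∀ k, α4 k * 2 ^ (ν + 1 + 2 ^ ν) ≤ lip k)
    (hlin : ∀ k s U (γ : Finset (Fin ν → ZMod N)) ω Y,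
      ‖c k s U γ ω Y‖ ≤ α4 k * Real.exp (-(a * (linSize (dom k γ Y) : ℝ))))
    (hdomconn : ∀ k (γ : Finset (Fin ν → ZMod N)) Y, (dom k γ Y).Nonempty →
      ∃ b ∈ dom k γ Y, Polymer.IsConn (torusAdj ν N) (dom k γ Y) b)
    (hdominj : ∀ k (γ : Finset (Fin ν → ZMod N)), Set.InjOn (dom k γ) {Y | (dom k γ Y).Nonempty})
    (hXconn : ∀ X, ∃ b, Polymer.IsConn (torusAdj ν N) (Γ.cubes X) b)
    (hcmp : ∀ X, κ * (doubleCarriers C).d X ≤ a'' * (linSize (Γ.cubes X) : ℝ))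
    (hε' : ∀ k, 0 ≤ ε' k)
    (hdecayLin : ∀ g ∈ W, ∀ (k : ℕ) (U : Bg) (X : (doubleCarriers C).Dom), (doubleCarriers C).scale X = k + 1 → ∀ γ' ∈ Γ.vol X,
      ∫ ω, ‖pre k (g k) U γ' ω‖ * Real.exp (boxExponent c pt β k (g k) U γ' ω) ∂(μ k (g k) U γ') ≤
        ε' k * Real.exp (-(a' * (linSize γ' : ℝ))))
    (ha₁ : 0 ≤ a₁) (ha'' : 0 ≤ a'')
    (hrate : (2:ℝ) ^ ν * Real.log 2 + Real.log (8 * ν) ≤ a' - a'' - 2 ^ ν * (a₁ + Real.log 2))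
    (hsmall : ∀ k, ((D : ℝ) + 1) * (2 * ε' k) * Real.exp (a'' * (ν + 1) + 2 ^ ν * (a₁ + Real.log 2)) *
      2 ^ (ν + 1 + 2 ^ ν) ≤ a₁)
    (hℓ : 0 ≤ ℓ) (hlam : ∀ k, lam k ≤ ℓ) :
    TermSize E W κ Nsz ∧
      NE9 E W κ (prodModuli ℓ fun _ => ω + 4 * lipbar * (a₁ * Real.exp (-(a'' * (ν + 1)))) * cQ) ∧
        FadingMemory (ℓ / (ω + 4 * lipbar * (a₁ * Real.exp (-(a'' * (ν + 1)))) * cQ))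
          (ω + 4 * lipbar * (a₁ * Real.exp (-(a'' * (ν + 1)))) * cQ)
          (prodModuli ℓ fun _ => ω + 4 * lipbar * (a₁ * Real.exp (-(a'' * (ν + 1)))) * cQ) := by
  -- S2 and the S5 package of the species are KERNEL (owner's part 2): restriction-closure of the analytic class, zero/locality/
  -- source discipline of the piece form, the per-piece bound ON THE ANALYTIC CLASS from analyticity + Schwarz + (1.24)/(1.25)
  exact torus_termSize_ne9_and_fadingMemory_of_linSizeDischargers_cpieceGain Γ Dd.toC ρ h0 hAdm (admRestrict_analyticClass Dd.R)
    (pieceZero_rem Dd) (pieceLocal_rem Dd) (csrcScale_rem hD) hA (pieceBoundOnG_rem hD hℓr κ) hLev (kpOf_nonneg hD) hO1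
    (fun k j => pow_nonneg (hℓr k j) 5) hcQ hω hfac hlast hρ hΨ hexpl hbase hNsucc hNnn hbox hpre hc hpt hlip hlipb hint₀ hmeet hα4
    ha hliplb hlin hdomconn hdominj hXconn hcmp hε' hdecayLin ha₁ ha'' hrate hsmall hℓ hlam

/-! ## §2 E5′-REM-π: the displayed species at its own letter `ω = L⁻¹` -/

/-- **E5′-REM-π — THE DISPLAYED SPECIES AT ITS OWN RATE LETTER `ω := L⁻¹`** (`1 < L`; [II] p. 8 l. 9–10 «(6L)⁴L^jη … 2(6L)⁴»:
gain exponent α = 1 for the fifth-order remainder family; c_Q generic here, (6L)⁴ in print): §1 at `ω := L⁻¹`.  Rate letter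
**`L⁻¹ + 4·lipbar·(a₁·e^{−a″(ν+1)})·c_Q`** — E5′-π's (p211212) with `(6L)⁴ ↦ c_Q`, now with S2/S5 KERNEL for the species.
[cite: Balaban1988RG2Cluster, (1.24)-(1.29) pp.7-8, p.8; Balaban1987RG1, (0.29)-(0.30) p.258] -/
theorem torus_termSize_ne9_and_fadingMemory_of_linSizeDischargers_remSpeciesPrinted
    (Γ : CubeChart (doubleCarriers C) (Fin ν → ZMod N) (torusAdj ν N) D) {ι αi βi γi δ : Type} [DecidableEq δ]
    (Dd : RemData C Bg ι αi βi γi δ) {ℓr : ℕ → ℕ → ℝ} {cdir d0 : ℝ}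
    {E : Functional (doubleCarriers C) Bg} {W : Set (ℕ → ℝ)}
    {Ψ : ℕ → ℝ → (ι → ℝ) → Bg → (doubleCarriers C).Dom → ℝ}
    {μ : ℕ → ℝ → Bg → Finset (Fin ν → ZMod N) → Measure Ω} {pre : ℕ → ℝ → Bg → Finset (Fin ν → ZMod N) → Ω → ℂ}
    {c : ℕ → ℝ → Bg → Finset (Fin ν → ZMod N) → Ω → F → ℂ}
    {pt : ℕ → ℝ → Bg → Finset (Fin ν → ZMod N) → Ω → F → Sp} {β : ℕ → Sp → ℝ}
    {dom : ℕ → Finset (Fin ν → ZMod N) → F → Finset (Fin ν → ZMod N)}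
    {lip ε' α4 : ℕ → ℝ} {a₁ a'' κ O1 cQ L lipbar ℓ a a' : ℝ}
    {lam p₀ Nsz : ℕ → ℝ}
    (ρ : ℕ → (ι → ℝ) → (Sp →ᵇ ℂ))
    -- the DISPLAYED SPECIES: its datum is admissible ((I.3.36) domain inclusion, radii, G1 — TYPE), the scale letter ℓ ≥ 0
    (hD : Dd.Admissible ℓr cdir d0) (hℓr : ∀ k j, 0 ≤ ℓr k j)
    -- S1 (the renormalised terms lie in the ANALYTIC class — [I] (1.18) p. 263, TYPE) and scale-zero freeness
    (h0 : ScaleZeroFree E W) (hAdm : AdmissibleTerms E W (analyticClass Dd.R))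
    -- S3's remaining half: additivity of the (1.23)-pieces in the old term ON THE ANALYTIC CLASS (crew row (w16); displayed here)
    (hA : PieceAdditiveOn (analyticClass Dd.R) Dd.toC)
    -- the level counts of [II] p. 8 on the species' index frame, against `c_Q·ω^{k−j}` (displayed), and the letters
    (hLev : LevelCountsG Dd.toC.frame κ Dd.κ₁ O1 cQ (fun k j => ℓr k j ^ 5) (agePow L⁻¹))
    (hO1 : 0 ≤ O1) (hcQ : 0 ≤ cQ) (hL1 : 1 < L)
    -- E5′'s remaining recursion-side binders at `T := cpieceChannel Dd.toC`, `wt := weightOf Dd.toC.frame Dd.κ₁ d0 O1 (KpOf Dd cdir)`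
    (hfac : Factorises E W (cpieceChannel Dd.toC) Ψ) (hlast : LastCouplingLipschitz E W (cpieceChannel Dd.toC) Ψ κ lam)
    (hρ : ∀ (k : ℕ) (Q Q' : ι → ℝ) (M : ℝ), (∀ y, |Q y - Q' y| ≤ weightOf Dd.toC.frame Dd.κ₁ d0 O1 (KpOf Dd cdir) k y * M) →
      ‖ρ k Q - ρ k Q'‖ ≤ M)
    (hΨ : ∀ (k : ℕ) (s : ℝ) (Q Q' : ι → ℝ) (U : Bg) (X : (doubleCarriers C).Dom),
      Ψ k s Q U X - Ψ k s Q' U X =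
        (Γ.geom.newTerm (Γ.geom.avgExpLinearAct μ pre fun k s U γ ω => evalFunctional (c k s U γ ω) (pt k s U γ ω))
            k s U X (ρ k Q) -
          Γ.geom.newTerm (Γ.geom.avgExpLinearAct μ pre fun k s U γ ω => evalFunctional (c k s U γ ω) (pt k s U γ ω))
            k s U X (ρ k Q')).re)
    (hexpl : ∀ g ∈ W, ∀ (k : ℕ) (Q : ι → ℝ) (U : Bg) (X : (doubleCarriers C).Dom), (doubleCarriers C).scale X = k + 1 →
      |Ψ k (g k) Q U X -
          (Γ.geom.newTerm (Γ.geom.avgExpLinearAct μ pre fun k s U γ ω => evalFunctional (c k s U γ ω) (pt k s U γ ω))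
            k (g k) U X (ρ k Q)).re| ≤ Real.exp (-(κ * (doubleCarriers C).d X)) * p₀ k)
    (hbase : ∀ g ∈ W, ∀ (U : Bg) (X : (doubleCarriers C).Dom), (doubleCarriers C).scale X = 0 → |E g U X| ≤ Real.exp (-(κ * (doubleCarriers C).d X)) * Nsz 0)
    (hNsucc : ∀ j, p₀ j + a₁ * Real.exp (-(a'' * (ν + 1))) ≤ Nsz (j + 1)) (hNnn : ∀ j, 0 ≤ Nsz j)
    (hbox : ∀ (k : ℕ) (Q : ι → ℝ),
      (∀ y, |Q y| ≤ weightOf Dd.toC.frame Dd.κ₁ d0 O1 (KpOf Dd cdir) k y * sizeRadius (tauOfG cQ (agePow L⁻¹)) Nsz k) → ∀ x, ‖ρ k Q x‖ ≤ β k x)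
    (hpre : ∀ k s U γ, AEStronglyMeasurable (pre k s U γ) (μ k s U γ))
    (hc : ∀ k s U γ Y, AEStronglyMeasurable (fun ω => c k s U γ ω Y) (μ k s U γ))
    (hpt : ∀ k s U γ Y, Measurable fun ω => pt k s U γ ω Y) (hlip : ∀ k, 0 < lip k) (hlipb : ∀ k, lip k ≤ lipbar)
    (hint₀ : ∀ k s U γ, Integrable (fun ω => ‖pre k s U γ ω‖ * Real.exp (boxExponent c pt β k s U γ ω)) (μ k s U γ))
    (hmeet : ∀ k s U (γ : Finset (Fin ν → ZMod N)) ω Y, c k s U γ ω Y ≠ 0 → ∃ x ∈ γ, x ∈ dom k γ Y)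
    (hα4 : ∀ k, 0 ≤ α4 k) (ha : (2:ℝ) ^ ν * Real.log 2 + Real.log (8 * ν) ≤ a)
    (hliplb : ∀ k, α4 k * 2 ^ (ν + 1 + 2 ^ ν) ≤ lip k)
    (hlin : ∀ k s U (γ : Finset (Fin ν → ZMod N)) ω Y,
      ‖c k s U γ ω Y‖ ≤ α4 k * Real.exp (-(a * (linSize (dom k γ Y) : ℝ))))
    (hdomconn : ∀ k (γ : Finset (Fin ν → ZMod N)) Y, (dom k γ Y).Nonempty →
      ∃ b ∈ dom k γ Y, Polymer.IsConn (torusAdj ν N) (dom k γ Y) b)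
    (hdominj : ∀ k (γ : Finset (Fin ν → ZMod N)), Set.InjOn (dom k γ) {Y | (dom k γ Y).Nonempty})
    (hXconn : ∀ X, ∃ b, Polymer.IsConn (torusAdj ν N) (Γ.cubes X) b)
    (hcmp : ∀ X, κ * (doubleCarriers C).d X ≤ a'' * (linSize (Γ.cubes X) : ℝ))
    (hε' : ∀ k, 0 ≤ ε' k)
    (hdecayLin : ∀ g ∈ W, ∀ (k : ℕ) (U : Bg) (X : (doubleCarriers C).Dom), (doubleCarriers C).scale X = k + 1 → ∀ γ' ∈ Γ.vol X,
      ∫ ω, ‖pre k (g k) U γ' ω‖ * Real.exp (boxExponent c pt β k (g k) U γ' ω) ∂(μ k (g k) U γ') ≤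
        ε' k * Real.exp (-(a' * (linSize γ' : ℝ))))
    (ha₁ : 0 ≤ a₁) (ha'' : 0 ≤ a'')
    (hrate : (2:ℝ) ^ ν * Real.log 2 + Real.log (8 * ν) ≤ a' - a'' - 2 ^ ν * (a₁ + Real.log 2))
    (hsmall : ∀ k, ((D : ℝ) + 1) * (2 * ε' k) * Real.exp (a'' * (ν + 1) + 2 ^ ν * (a₁ + Real.log 2)) *
      2 ^ (ν + 1 + 2 ^ ν) ≤ a₁)
    (hℓ : 0 ≤ ℓ) (hlam : ∀ k, lam k ≤ ℓ) :
    TermSize E W κ Nsz ∧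
      NE9 E W κ (prodModuli ℓ fun _ => L⁻¹ + 4 * lipbar * (a₁ * Real.exp (-(a'' * (ν + 1)))) * cQ) ∧
        FadingMemory (ℓ / (L⁻¹ + 4 * lipbar * (a₁ * Real.exp (-(a'' * (ν + 1)))) * cQ))
          (L⁻¹ + 4 * lipbar * (a₁ * Real.exp (-(a'' * (ν + 1)))) * cQ)
          (prodModuli ℓ fun _ => L⁻¹ + 4 * lipbar * (a₁ * Real.exp (-(a'' * (ν + 1)))) * cQ) :=
  torus_termSize_ne9_and_fadingMemory_of_linSizeDischargers_remSpecies Γ Dd ρ hD hℓr h0 hAdm hA hLev hO1 hcQ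
    (inv_pos.mpr (by linarith)) hfac hlast hρ hΨ hexpl hbase hNsucc hNnn hbox hpre hc hpt hlip hlipb hint₀ hmeet hα4 ha hliplb hlin
    hdomconn hdominj hXconn hcmp hε' hdecayLin ha₁ ha'' hrate hsmall hℓ hlam

end Species

end Summit.QuantumFields.BalabanUV.T4Continuum.NE9LinSizeEndRemSpecies

end
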